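import Literature.Computability.AlgebraicComplexity.RectangularExponentProofs
import Literature.Computability.AlgebraicComplexity.RectangularExponentUnidimensionalAsymptotics
import Literature.Computability.AlgebraicComplexity.RectangularExponentAlpha
import Literature.Computability.AlgebraicComplexity.SchonhageRectangular
import Literature.Computability.AlgebraicComplexity.AsymptoticRankBorderRank
import Mathlib.Analysis.Convex.Deriv
import Mathlib.Analysis.MeanInequalities
import HarnessLib

/-!
# Route `FarEdgeDescent` — the virtual spectral point of the far edge (kernel XXVII)

decomp-mm ROOT cell (D-0178), lens 2 «structural dichotomy: special vs generic», gen 51.  THESES-FREE and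
definition-free (imports `Literature` and Mathlib only).  Write `f(y) = ω(1,y,1) = omegaRect K 1 y 1`
(any field `K`) and `e(x) = f(x) − (x+1) ≥ 0` for the far-edge excess.

THE READOUT LEVER.  Kernels XXIV–XXVI read a border-rank certificate through ONE word class at ONE
abscissa and transport by antitonicity; that readout caps every anchored tower of the tree at the pair
order `δ₂ = log 2/log(11/2) = 0.4066` (kernel XXVI, census I118).  Here the certificate is read at a
VIRTUAL SPECTRAL POINT instead: `f` is CONVEX on `[0,∞)` (Lotti–Romani 1983 §2, the tree's
`omegaRect_convexOn_one_mid_one`), so at every `x₀ > 0` it has a supporting line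
`y ↦ s + t·y ≤ f(y)` (`t` = the right derivative, `0 ≤ t ≤ 1`, `1 ≤ s ≤ 2`, `s + t·x₀ = f(x₀)`;
`exists_supportSlope`, `exists_virtualPoint`).  The pair `(s,t)` behaves exactly like a point of
Strassen's asymptotic spectrum restricted to the words `⟨a,B,a⟩` — WITHOUT any spectral theorem:
by Schönhage's rectangular asymptotic sum inequality (tree: `mul_rpow_omegaRect_mid_le_asymptoticRank`)
every multiple word obeys `c·a^s·B^t ≤ R̃(⟨c⟩ ⊗ ⟨a,B,a⟩) ≤ bR(…)` (`mul_rpow_mul_rpow_le_asymptoticRank`,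
`mul_rpow_mul_rpow_le_of_algBorderRank_le`; the anchor word `⟨1,B,1⟩` obeys `B^t ≤ B`,
`anchor_rpow_le`), and the excess is read off the point itself:
`e(x₀) = (s − 1) − x₀·(1 − t)` (`exists_virtualPoint_excess_eq`).  Hence the EXCLUSION PRINCIPLE
(`excess_le_of_virtualPoints`, `excess_le_of_certificates`): to prove `e(x₀) ≤ η` it suffices that every
`(s,t) ∈ [1,2]×[0,1]` obeying all certificate inequalities has `(s−1) − x₀(1−t) ≤ η` — different
certificates may exclude different `t` (the `∀t ∃stage` order that single-class readout cannot use).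
RATE CONVERSION (`mul_rpow_sub_mul_le`, weighted AM–GM = Legendre transform of a power;
`excess_le_rpow_of_virtualPowerBound`): if the certificates confine the virtual points to
`s − 1 ≤ C·(1−t)^κ` (`0 < κ < 1`) then `e(x) ≤ (1−κ)·(C κ^κ x^{−κ})^{1/(1−κ)} = O(x^{−κ/(1−κ)})`.
TARGET IT SERVES (cell memo NODE-g51, instrument `tower_sim.py`): the FULL squaring tower of
Pan 1984 §16–17 / Stothers 2010 Thm 8 (`⟨3,1,3⟩ ⊕ ⟨1,4,1⟩ ≤ 10`, square, keep ALL words, re-anchor with the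
two-leg loss: `r_i = 10^{2^i}`, legs `(r_i − 1)/3`, anchor `⟨1,(r_i+2)/3,1⟩` — «the anchor is a third»)
confines the virtual points to `s − 1 ≤ C(1−t)^κ` with `κ = log₂(4/3)` (deviation multiplier `4/3` per
squaring at the superstable fixed point `m = 1/3`), whence the order
`κ/(1−κ) = log(4/3)/log(3/2) = 0.70951…` (`stothersOrder_eq`) against the tree's `δ₂ = 0.40660`.
NO definitions (gate rule D-0009).
[cite: LottiRomani1983, §2 (p. 174)] [cite: AlmanDuanVassilevskaWilliamsXuXuZhou2025, Thm. 3.2]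
[cite: Pan1984, §16 Prop. 16.2–16.5, §17] [cite: Stothers2010, Thm. 8]
[cite: CoppersmithWinograd1982, Thm. 1] [cite: KnuthTAOCP2, §4.6.4, Ex. 67(g)]
-/

set_option linter.dupNamespace false

noncomputable section

open Set

namespace Summit.MatrixMultiplication.MatrixMultiplication.Theorems.FarEdgeDescentVirtualPoint

open Literature.Computability.AlgebraicComplexity

variable (K : Type) [Field K]

/-! ## §1 The supporting line of the convex `y ↦ ω(1,y,1)` -/

/-- **Supporting line at `x₀ > 0`.**  `f = ω(1,·,1)` is convex on `[0,∞)` (Lotti–Romani §2), monotone and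
`f(x+d) ≤ f(x)+d`; its right derivative `σ` at an interior point satisfies `0 ≤ σ ≤ 1` and
`f(x₀) + σ(y − x₀) ≤ f(y)` for every `y ≥ 0`. [cite: LottiRomani1983, §2 (p. 174)] -/
theorem exists_supportSlope {x₀ : ℝ} (hx₀ : 0 < x₀) :
    ∃ σ : ℝ, 0 ≤ σ ∧ σ ≤ 1 ∧
      ∀ y : ℝ, 0 ≤ y → omegaRect K 1 x₀ 1 + σ * (y - x₀) ≤ omegaRect K 1 y 1 := by
  set f : ℝ → ℝ := fun k => omegaRect K 1 k 1 with hf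
  have hconv : ConvexOn ℝ (Ici (0 : ℝ)) f := omegaRect_convexOn_one_mid_one K
  have hint : x₀ ∈ interior (Ici (0 : ℝ)) := by
    rw [interior_Ici]
    exact hx₀
  have hLR := hconv.leftDeriv_le_rightDeriv_of_mem_interior hint
  refine ⟨derivWithin f (Ioi x₀) x₀, ?_, ?_, ?_⟩
  · have hmem : x₀ / 2 ∈ Ici (0 : ℝ) := by
      rw [mem_Ici]; linarith
    have h1 : slope f (x₀ / 2) x₀ ≤ derivWithin f (Iio x₀) x₀ :=
      hconv.slope_le_leftDeriv_of_mem_interior hmem hint (by linarith)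
    have h3 : 0 ≤ slope f (x₀ / 2) x₀ := by
      rw [slope_def_field]
      exact div_nonneg (sub_nonneg.2 (omegaRect_one_mid_one_mono K (by linarith))) (by linarith)
    linarith
  · have hmem : x₀ + 1 ∈ Ici (0 : ℝ) := by
      rw [mem_Ici]; linarith
    have h1 : derivWithin f (Ioi x₀) x₀ ≤ slope f x₀ (x₀ + 1) :=
      hconv.rightDeriv_le_slope_of_mem_interior hint hmem (by linarith)
    have h2 : slope f x₀ (x₀ + 1) ≤ 1 := by
      rw [slope_def_field]
      have h := omegaRect_one_mid_one_add_le K x₀ (zero_le_one)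
      have hd : x₀ + 1 - x₀ = 1 := by ring
      rw [hd, div_one]
      show omegaRect K 1 (x₀ + 1) 1 - omegaRect K 1 x₀ 1 ≤ 1
      linarith
    linarith
  · intro y hy
    rcases lt_trichotomy x₀ y with hlt | heq | hgt
    · have h1 : derivWithin f (Ioi x₀) x₀ ≤ slope f x₀ y :=
        hconv.rightDeriv_le_slope_of_mem_interior hint (mem_Ici.2 hy) hlt
      rw [slope_def_field, le_div_iff₀ (sub_pos.2 hlt)] at h1
      show omegaRect K 1 x₀ 1 + derivWithin f (Ioi x₀) x₀ * (y - x₀) ≤ omegaRect K 1 y 1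
      have h1' : derivWithin f (Ioi x₀) x₀ * (y - x₀) ≤ f y - f x₀ := h1
      simp only [hf] at h1'
      linarith
    · subst heq
      simp
    · have h1 : slope f y x₀ ≤ derivWithin f (Iio x₀) x₀ :=
        hconv.slope_le_leftDeriv_of_mem_interior (mem_Ici.2 hy) hint hgt
      rw [slope_def_field, div_le_iff₀ (sub_pos.2 hgt)] at h1
      have h1' : f x₀ - f y ≤ derivWithin f (Iio x₀) x₀ * (x₀ - y) := h1
      have h2 : derivWithin f (Iio x₀) x₀ * (x₀ - y) ≤ derivWithin f (Ioi x₀) x₀ * (x₀ - y) :=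
        mul_le_mul_of_nonneg_right hLR (sub_pos.2 hgt).le
      simp only [hf] at h1'
      show omegaRect K 1 x₀ 1 + derivWithin f (Ioi x₀) x₀ * (y - x₀) ≤ omegaRect K 1 y 1
      nlinarith

/-! ## §2 The virtual spectral point `(s,t)` at `x₀` -/

/-- **The virtual point at `x₀ > 0`.**  There are `s ∈ [1,2]`, `t ∈ [0,1]` with `s + x₀ t = ω(1,x₀,1)`
and `s + y t ≤ ω(1,y,1)` for all `y ≥ 0` (the supporting line `s = f(x₀) − σx₀`, `t = σ`;
`s ≥ (x₀+1) − x₀`, `s ≤ f(0) = 2`). [cite: LottiRomani1983, §2 (p. 174)] -/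
theorem exists_virtualPoint {x₀ : ℝ} (hx₀ : 0 < x₀) :
    ∃ s t : ℝ, (0 ≤ t ∧ t ≤ 1) ∧ (1 ≤ s ∧ s ≤ 2) ∧ s + x₀ * t = omegaRect K 1 x₀ 1 ∧
      ∀ y : ℝ, 0 ≤ y → s + y * t ≤ omegaRect K 1 y 1 := by
  obtain ⟨σ, h0, h1, hsup⟩ := exists_supportSlope K hx₀
  refine ⟨omegaRect K 1 x₀ 1 - σ * x₀, σ, ⟨h0, h1⟩, ⟨?_, ?_⟩, by ring, ?_⟩
  · have h := one_le_omegaRect_one_mid_one_sub K x₀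
    nlinarith
  · have h := hsup 0 le_rfl
    rw [omegaRect_one_zero_one K] at h
    linarith
  · intro y hy
    have h := hsup y hy
    linarith

/-- **The excess read off the virtual point**: with `(s,t)` as above,
`e(x₀) = ω(1,x₀,1) − (x₀+1) = (s − 1) − x₀ (1 − t)` (`v = s − 1 ∈ [0,1]`, `u = 1 − t ∈ [0,1]` in the cell
memo's coordinates). [cite: LottiRomani1983, §2 (p. 174)] -/
theorem exists_virtualPoint_excess_eq {x₀ : ℝ} (hx₀ : 0 < x₀) :
    ∃ s t : ℝ, (0 ≤ t ∧ t ≤ 1) ∧ (1 ≤ s ∧ s ≤ 2) ∧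
      (∀ y : ℝ, 0 ≤ y → s + y * t ≤ omegaRect K 1 y 1) ∧
      omegaRect K 1 x₀ 1 - (x₀ + 1) = (s - 1) - x₀ * (1 - t) := by
  obtain ⟨s, t, ht, hs, heq, hsup⟩ := exists_virtualPoint K hx₀
  exact ⟨s, t, ht, hs, hsup, by rw [← heq]; ring⟩

/-! ## §3 Virtual points obey every multiple-word certificate -/

/-- **Schönhage readout at a sub-tangent point.**  If `s + y t ≤ ω(1,y,1)` for all `y ≥ 0`, then for
`c ≥ 1`, `a ≥ 2`, `B ≥ 1`: `c · a^s · B^t ≤ R̃(⟨c⟩ ⊗ ⟨a,B,a⟩)` (take `y = log_a B`, so `a^y = B` and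
`a^s B^t = a^{s + y t} ≤ a^{ω(1,y,1)}`, then the tree's `c·a^{ω(1,y,1)} ≤ R̃(⟨c⟩ ⊗ ⟨a,B,a⟩)`).
[cite: AlmanDuanVassilevskaWilliamsXuXuZhou2025, Thm. 3.2] -/
theorem mul_rpow_mul_rpow_le_asymptoticRank {s t : ℝ}
    (hst : ∀ y : ℝ, 0 ≤ y → s + y * t ≤ omegaRect K 1 y 1)
    {c a B : ℕ} (hc : 1 ≤ c) (ha : 2 ≤ a) (hB : 1 ≤ B) :
    (c : ℝ) * ((a : ℝ) ^ s * (B : ℝ) ^ t) ≤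
      asymptoticRank (kroneckerTensor (unitTensor K c) (matMulTensor K a B a)) := by
  have ha1 : (1 : ℝ) < a := by exact_mod_cast (by omega : 1 < a)
  have ha0 : (0 : ℝ) < a := by linarith
  have hB1 : (1 : ℝ) ≤ B := by exact_mod_cast hB
  have hB0 : (0 : ℝ) < B := by linarith
  set k : ℝ := Real.logb a B with hk
  have hk0 : 0 ≤ k := Real.logb_nonneg ha1 hB1
  have hak : (a : ℝ) ^ k = B := Real.rpow_logb ha0 ha1.ne' hB0
  have h1 := mul_rpow_omegaRect_mid_le_asymptoticRank K hk0 hc ha hak.le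
  have h2 : (a : ℝ) ^ s * (B : ℝ) ^ t ≤ (a : ℝ) ^ omegaRect K 1 k 1 := by
    have h := hst k hk0
    calc (a : ℝ) ^ s * (B : ℝ) ^ t = (a : ℝ) ^ s * ((a : ℝ) ^ k) ^ t := by rw [hak]
      _ = (a : ℝ) ^ (s + k * t) := by rw [← Real.rpow_mul ha0.le, Real.rpow_add ha0]
      _ ≤ (a : ℝ) ^ omegaRect K 1 k 1 := Real.rpow_le_rpow_of_exponent_le ha1.le h
  have hc0 : (0 : ℝ) ≤ c := by positivity
  exact (mul_le_mul_of_nonneg_left h2 hc0).trans h1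

/-- **Border-rank form**: a certificate `bR(⟨c⟩ ⊗ ⟨a,B,a⟩) ≤ r` (`c ≥ 1`, `a ≥ 2`, `B ≥ 1`) forces
`c · a^s · B^t ≤ r` at every sub-tangent point (`R̃ ≤ bR`, BCS Lemma (15.27)).
[cite: BurgisserClausenShokrollahi1997, Lemma (15.27)] [cite: AlmanDuanVassilevskaWilliamsXuXuZhou2025, Thm. 3.2] -/
theorem mul_rpow_mul_rpow_le_of_algBorderRank_le {s t : ℝ}
    (hst : ∀ y : ℝ, 0 ≤ y → s + y * t ≤ omegaRect K 1 y 1)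
    {c a B r : ℕ} (hc : 1 ≤ c) (ha : 2 ≤ a) (hB : 1 ≤ B)
    (hr : algBorderRank (kroneckerTensor (unitTensor K c) (matMulTensor K a B a)) ≤ r) :
    (c : ℝ) * ((a : ℝ) ^ s * (B : ℝ) ^ t) ≤ r :=
  (mul_rpow_mul_rpow_le_asymptoticRank K hst hc ha hB).trans (asymptoticRank_le_of_algBorderRank_le hr)

/-- **The anchor word** `⟨1,B,1⟩`: at a point with `t ≤ 1`, `B^t ≤ B` for `B ≥ 1` (its flattening rank;
no tensor argument needed). [folklore] -/
theorem anchor_rpow_le {t : ℝ} (ht : t ≤ 1) {B : ℕ} (hB : 1 ≤ B) : (B : ℝ) ^ t ≤ B := by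
  have hB1 : (1 : ℝ) ≤ B := by exact_mod_cast hB
  have h := Real.rpow_le_rpow_of_exponent_le hB1 ht
  rwa [Real.rpow_one] at h

/-! ## §4 The exclusion principle -/

/-- **EXCLUSION PRINCIPLE.**  To bound the far-edge excess at `x₀ > 0` by `η` it suffices that every
sub-tangent point `(s,t) ∈ [1,2] × [0,1]` of `ω(1,·,1)` has `(s−1) − x₀(1−t) ≤ η`.
[cite: LottiRomani1983, §2 (p. 174)] -/
theorem excess_le_of_virtualPoints {x₀ η : ℝ} (hx₀ : 0 < x₀)
    (h : ∀ s t : ℝ, 0 ≤ t → t ≤ 1 → 1 ≤ s → s ≤ 2 →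
      (∀ y : ℝ, 0 ≤ y → s + y * t ≤ omegaRect K 1 y 1) → (s - 1) - x₀ * (1 - t) ≤ η) :
    omegaRect K 1 x₀ 1 - (x₀ + 1) ≤ η := by
  obtain ⟨s, t, ht, hs, hsup, heq⟩ := exists_virtualPoint_excess_eq K hx₀
  rw [heq]
  exact h s t ht.1 ht.2 hs.1 hs.2 hsup

/-- **EXCLUSION BY CERTIFICATES.**  To bound `e(x₀)` by `η` it suffices that every
`(s,t) ∈ [1,2] × [0,1]` which satisfies ALL multiple-word border-rank certificate inequalities
`bR(⟨c⟩ ⊗ ⟨a,B,a⟩) ≤ r ⟹ c a^s B^t ≤ r` has `(s−1) − x₀(1−t) ≤ η`: different certificates may exclude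
different `t`, which single-class readout (kernels XXIV–XXVI) cannot exploit.
[cite: AlmanDuanVassilevskaWilliamsXuXuZhou2025, Thm. 3.2] [cite: LottiRomani1983, §2 (p. 174)] -/
theorem excess_le_of_certificates {x₀ η : ℝ} (hx₀ : 0 < x₀)
    (h : ∀ s t : ℝ, 0 ≤ t → t ≤ 1 → 1 ≤ s → s ≤ 2 →
      (∀ c a B r : ℕ, 1 ≤ c → 2 ≤ a → 1 ≤ B →
          algBorderRank (kroneckerTensor (unitTensor K c) (matMulTensor K a B a)) ≤ r →
          (c : ℝ) * ((a : ℝ) ^ s * (B : ℝ) ^ t) ≤ r) →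
      (s - 1) - x₀ * (1 - t) ≤ η) :
    omegaRect K 1 x₀ 1 - (x₀ + 1) ≤ η :=
  excess_le_of_virtualPoints K hx₀ fun s t ht0 ht1 hs1 hs2 hsup =>
    h s t ht0 ht1 hs1 hs2 fun _ _ _ _ hc ha hB hr =>
      mul_rpow_mul_rpow_le_of_algBorderRank_le K hsup hc ha hB hr

/-! ## §5 Rate conversion: a power-law wedge of virtual points gives a power-law rate -/

/-- **Legendre transform of a power** (weighted AM–GM): for `C ≥ 0`, `0 < κ < 1`, `x > 0`, `u ≥ 0`,
`C u^κ − x u ≤ (1 − κ) · (C κ^κ x^{−κ})^{1/(1−κ)}` (the exact value of `sup_u (C u^κ − x u)`).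
[folklore] -/
theorem mul_rpow_sub_mul_le {C κ x u : ℝ} (hC : 0 ≤ C) (hκ0 : 0 < κ) (hκ1 : κ < 1) (hx : 0 < x)
    (hu : 0 ≤ u) :
    C * u ^ κ - x * u ≤ (1 - κ) * (C * κ ^ κ * x ^ (-κ)) ^ (1 / (1 - κ)) := by
  have h1κ : 0 < 1 - κ := by linarith
  set p₁ : ℝ := x * u / κ with hp₁
  set y : ℝ := C * κ ^ κ * x ^ (-κ) with hy
  have hy0 : 0 ≤ y := by positivity
  set p₂ : ℝ := y ^ (1 / (1 - κ)) with hp₂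
  have hp₁0 : 0 ≤ p₁ := by positivity
  have hp₂0 : 0 ≤ p₂ := by positivity
  -- weighted AM–GM: `p₁^κ p₂^{1−κ} ≤ κ p₁ + (1−κ) p₂`
  have hag := Real.geom_mean_le_arith_mean2_weighted hκ0.le h1κ.le hp₁0 hp₂0 (by ring)
  -- `p₂^{1−κ} = y`
  have hp₂pow : p₂ ^ (1 - κ) = y := by
    rw [hp₂, ← Real.rpow_mul hy0, one_div_mul_cancel h1κ.ne', Real.rpow_one]
  -- `p₁^κ = (x/κ)^κ u^κ`
  have hp₁pow : p₁ ^ κ = (x / κ) ^ κ * u ^ κ := by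
    rw [hp₁, show x * u / κ = x / κ * u by ring, Real.mul_rpow (by positivity) hu]
  -- `(x/κ)^κ · κ^κ · x^{−κ} = 1`
  have hunit : (x / κ) ^ κ * (κ ^ κ * x ^ (-κ)) = 1 := by
    rw [Real.div_rpow hx.le hκ0.le, Real.rpow_neg hx.le]
    have hκκ : 0 < κ ^ κ := Real.rpow_pos_of_pos hκ0 κ
    have hxκ : 0 < x ^ κ := Real.rpow_pos_of_pos hx κ
    field_simp
  have hprod : p₁ ^ κ * p₂ ^ (1 - κ) = C * u ^ κ := by
    rw [hp₂pow, hp₁pow, hy]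
    have : (x / κ) ^ κ * u ^ κ * (C * κ ^ κ * x ^ (-κ)) =
        C * u ^ κ * ((x / κ) ^ κ * (κ ^ κ * x ^ (-κ))) := by ring
    rw [this, hunit, mul_one]
  have hκp₁ : κ * p₁ = x * u := by
    rw [hp₁]; field_simp
  rw [hprod, hκp₁] at hag
  linarith

/-- **Power-law wedge ⟹ power-law rate.**  If every sub-tangent point `(s,t) ∈ [1,2]×[0,1]` of
`ω(1,·,1)` satisfies `s − 1 ≤ C (1−t)^κ` (`C ≥ 0`, `0 < κ < 1`) — the shape the anchored towers'
certificates cut out — then for every `x > 0`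
`ω(1,x,1) − (x+1) ≤ (1−κ)·(C κ^κ x^{−κ})^{1/(1−κ)} = O(x^{−κ/(1−κ)})`.
[cite: LottiRomani1983, §2 (p. 174)] -/
theorem excess_le_rpow_of_virtualPowerBound {C κ : ℝ} (hC : 0 ≤ C) (hκ0 : 0 < κ) (hκ1 : κ < 1)
    (hV : ∀ s t : ℝ, 0 ≤ t → t ≤ 1 → 1 ≤ s → s ≤ 2 →
      (∀ y : ℝ, 0 ≤ y → s + y * t ≤ omegaRect K 1 y 1) → s - 1 ≤ C * (1 - t) ^ κ)
    {x : ℝ} (hx : 0 < x) :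
    omegaRect K 1 x 1 - (x + 1) ≤ (1 - κ) * (C * κ ^ κ * x ^ (-κ)) ^ (1 / (1 - κ)) := by
  refine excess_le_of_virtualPoints K hx fun s t ht0 ht1 hs1 hs2 hsup => ?_
  have h1 := hV s t ht0 ht1 hs1 hs2 hsup
  have h2 := mul_rpow_sub_mul_le hC hκ0 hκ1 hx (sub_nonneg.2 ht1)
  linarith

/-- The same with the exponent displayed: `(C κ^κ x^{−κ})^{1/(1−κ)} = (C κ^κ)^{1/(1−κ)} · x^{−(κ/(1−κ))}`
for `x > 0`. [folklore] -/
theorem wedge_rpow_eq {C κ x : ℝ} (hC : 0 ≤ C) (hκ0 : 0 < κ) (hκ1 : κ < 1) (hx : 0 < x) :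
    (C * κ ^ κ * x ^ (-κ)) ^ (1 / (1 - κ)) =
      (C * κ ^ κ) ^ (1 / (1 - κ)) * x ^ (-(κ / (1 - κ))) := by
  have h1κ : 0 < 1 - κ := by linarith
  have hCκ : 0 ≤ C * κ ^ κ := by positivity
  rw [Real.mul_rpow hCκ (Real.rpow_nonneg hx.le _), ← Real.rpow_mul hx.le]
  congr 2
  field_simp

/-- **The far-edge excess is `O(x^{−κ/(1−κ)})` under a `κ`-wedge** (the two previous facts combined).
[cite: LottiRomani1983, §2 (p. 174)] -/
theorem excess_le_const_mul_rpow_of_virtualPowerBound {C κ : ℝ} (hC : 0 ≤ C) (hκ0 : 0 < κ)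
    (hκ1 : κ < 1)
    (hV : ∀ s t : ℝ, 0 ≤ t → t ≤ 1 → 1 ≤ s → s ≤ 2 →
      (∀ y : ℝ, 0 ≤ y → s + y * t ≤ omegaRect K 1 y 1) → s - 1 ≤ C * (1 - t) ^ κ)
    {x : ℝ} (hx : 0 < x) :
    omegaRect K 1 x 1 - (x + 1) ≤
      (1 - κ) * (C * κ ^ κ) ^ (1 / (1 - κ)) * x ^ (-(κ / (1 - κ))) := by
  have h := excess_le_rpow_of_virtualPowerBound K hC hκ0 hκ1 hV hx
  rw [wedge_rpow_eq hC hκ0 hκ1 hx] at h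
  linarith [h]

/-! ## §6 The order of the full squaring tower -/

/-- **The Stothers order.**  With `κ = log(4/3)/log 2` (deviation multiplier `4/3` per squaring, clock `2`)
the rate exponent `κ/(1−κ)` equals `log(4/3)/log(3/2)` (`= 0.70951…`; `1 − κ = log(3/2)/log 2`).
[cite: Pan1984, §17] [cite: Stothers2010, Thm. 8] -/
theorem stothersOrder_eq :
    Real.log (4 / 3) / Real.log 2 / (1 - Real.log (4 / 3) / Real.log 2) =
      Real.log (4 / 3) / Real.log (3 / 2) := by
  have hlog2 : 0 < Real.log 2 := Real.log_pos (by norm_num)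
  have h32 : Real.log (3 / 2) = Real.log 2 - Real.log (4 / 3) := by
    have h : (3 / 2 : ℝ) = 2 / (4 / 3) := by norm_num
    rw [h, Real.log_div (by norm_num) (by norm_num)]
  have hlog32 : 0 < Real.log (3 / 2) := Real.log_pos (by norm_num)
  rw [h32] at hlog32 ⊢
  field_simp

/-- `0 < log(4/3)/log 2 < 1`: the Stothers wedge exponent is a genuine `κ ∈ (0,1)`. [folklore] -/
theorem stothersKappa_mem_Ioo :
    0 < Real.log (4 / 3) / Real.log 2 ∧ Real.log (4 / 3) / Real.log 2 < 1 := by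
  have hlog2 : 0 < Real.log 2 := Real.log_pos (by norm_num)
  have hlog43 : 0 < Real.log (4 / 3) := Real.log_pos (by norm_num)
  have hlt : Real.log (4 / 3) < Real.log 2 := Real.log_lt_log (by norm_num) (by norm_num)
  exact ⟨div_pos hlog43 hlog2, (div_lt_one hlog2).2 hlt⟩

/-- **The pair order is beaten**: `log 2/log(11/2) < log(4/3)/log(3/2)`, i.e.
`log 2 · log(3/2) < log(4/3) · log(11/2)`; since `(3/2)^12 < 2^7` and `2^12 < (4/3)^29`… we use the cruder
chain `log(3/2) < (5/12) log 2`-free route: `(3/2)^5 < 2^3` gives `5 log(3/2) < 3 log 2`, and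
`2^5 = 32 < (4/3)^… ` — precisely: `(3/2)^5 = 7.59 < 8 = 2^3` and `(11/2)^3 = 166.4 > 2^7 = 128`
and `(4/3)^5 = 4.21 > 4 = 2^2`, so `log(3/2)/log 2 < 3/5`, `log(11/2)/log 2 > 7/3`, `log(4/3)/log 2 > 2/5`,
and `3/5 < (2/5)(7/3) = 14/15`. [folklore] -/
theorem pairOrder_lt_stothersOrder :
    Real.log 2 / Real.log (11 / 2) < Real.log (4 / 3) / Real.log (3 / 2) := by
  have hlog2 : 0 < Real.log 2 := Real.log_pos (by norm_num)
  have hlog32 : 0 < Real.log (3 / 2) := Real.log_pos (by norm_num)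
  have hlog112 : 0 < Real.log (11 / 2) := Real.log_pos (by norm_num)
  have hlog43 : 0 < Real.log (4 / 3) := Real.log_pos (by norm_num)
  -- `5 log(3/2) < 3 log 2`
  have h1 : 5 * Real.log (3 / 2) < 3 * Real.log 2 := by
    rw [← Real.log_rpow (by norm_num), ← Real.log_rpow (by norm_num)]
    exact Real.log_lt_log (by positivity) (by norm_num)
  -- `7 log 2 < 3 log(11/2)`
  have h2 : 7 * Real.log 2 < 3 * Real.log (11 / 2) := by
    rw [← Real.log_rpow (by norm_num), ← Real.log_rpow (by norm_num)]
    exact Real.log_lt_log (by positivity) (by norm_num)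
  -- `2 log 2 < 5 log(4/3)`
  have h3 : 2 * Real.log 2 < 5 * Real.log (4 / 3) := by
    rw [← Real.log_rpow (by norm_num), ← Real.log_rpow (by norm_num)]
    exact Real.log_lt_log (by positivity) (by norm_num)
  rw [div_lt_div_iff₀ hlog112 hlog32]
  nlinarith

end Summit.MatrixMultiplication.MatrixMultiplication.Theorems.FarEdgeDescentVirtualPoint

end
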